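import Summits.QuantumFields.YangMills.Theorems.ScalingWindowSplitSelfNormalisedSkewnessWitnessPerSite
import Literature.Probability.LatticeModels.BesselIDebyeAsymptotics
import HarnessLib

/-!
# `SelfNormalisedSkewness` — negative side: numerics of the super-weak scheme

Route `ScalingWindowSplit`, crux `stmt-QuantumFields-18944`, line `Sketch` (negation branch), support for the
lead's `stub_witnessAssembly`.  Along the witness scheme `a_k = 1/n`, `β_k = n^{96}`, `L_k = n²` (`n = k+1`,
torus side `S_k = 2n²+1`) with the auxiliary small-field scale `ε_k = n^{-43} = β_k^{-1/2} a_k^{-5}` and the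
link scale `δ_k = n^{-48} = β_k^{-1/2}` we record the elementary size bookkeeping (`#P ≤ 486 n⁸`, `S⁴ε ≤ 81 n^{-35}`,
`β #P ε⁴ ≤ 486 n^{-68}`, `#P (ε√β)^{-6} ≤ 486 n^{-22}`) and the large-field estimate
`μ_β(G_εᶜ) ≤ exp(−n^{10}/4 + 20412 n⁹)`, eventually `≤ n^{-312}`.

References: Lüscher 1999 §3; standard.  No definitions of propositions, no named facts.
-/

noncomputable section

open scoped BigOperators ENNReal
open MeasureTheory Filter Topology
open Literature.MathematicalPhysics.QuantumLattice Literature.MathematicalPhysics.QuantumFieldTheory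
open Summit.QuantumFields.YangMills.Theorems.CurvatureBoostCovariance.Negative (card_planes)

namespace Summit.QuantumFields.YangMills.Theorems.SelfNormalisedSkewness.Negative

/-! ### The scales -/

/-- `n_k = k + 1` as a real number. [folklore] -/
def nR (k : ℕ) : ℝ := (k : ℝ) + 1

/-- `0 < n_k`. [folklore] -/
theorem nR_pos (k : ℕ) : 0 < nR k := by unfold nR; positivity

/-- `1 ≤ n_k`. [folklore] -/
theorem one_le_nR (k : ℕ) : 1 ≤ nR k := by unfold nR; have := Nat.cast_nonneg (α := ℝ) k; linarith

/-- `n_k = ↑(k+1)`. [folklore] -/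
theorem nR_eq_cast (k : ℕ) : nR k = ((k + 1 : ℕ) : ℝ) := by unfold nR; push_cast; ring

/-- The small-field scale `ε_k = n^{-43}`. [folklore] -/
def epsW (k : ℕ) : ℝ := (nR k ^ 43)⁻¹

/-- The link scale `δ_k = n^{-48}`. [folklore] -/
def deltaW (k : ℕ) : ℝ := (nR k ^ 48)⁻¹

/-- `0 < ε_k`. [folklore] -/
theorem epsK_pos (k : ℕ) : 0 < epsW k := by unfold epsW; exact inv_pos.2 (pow_pos (nR_pos k) _)

/-- `ε_k ≤ 1`. [folklore] -/
theorem epsK_le_one (k : ℕ) : epsW k ≤ 1 := by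
  unfold epsW; exact inv_le_one_of_one_le₀ (one_le_pow₀ (one_le_nR k))

/-- `0 < δ_k`. [folklore] -/
theorem deltaK_pos (k : ℕ) : 0 < deltaW k := by unfold deltaW; exact inv_pos.2 (pow_pos (nR_pos k) _)

/-- `δ_k ≤ n⁻¹`. [folklore] -/
theorem deltaK_le_inv (k : ℕ) : deltaW k ≤ (nR k)⁻¹ := by
  unfold deltaW
  refine inv_anti₀ (nR_pos k) ?_
  calc nR k = nR k ^ 1 := (pow_one _).symm
    _ ≤ nR k ^ 48 := pow_le_pow_right₀ (one_le_nR k) (by norm_num)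

/-- `√β_k = n^{48}`. [folklore] -/
theorem sqrt_beta (k : ℕ) : Real.sqrt (nR k ^ 96) = nR k ^ 48 := by
  rw [show nR k ^ 96 = (nR k ^ 48) ^ 2 by ring, Real.sqrt_sq (pow_nonneg (nR_pos k).le _)]

/-- `ε_k √β_k = n⁵`. [folklore] -/
theorem eps_mul_sqrt_beta (k : ℕ) : epsW k * Real.sqrt (nR k ^ 96) = nR k ^ 5 := by
  rw [sqrt_beta, epsW]; field_simp [(nR_pos k).ne']

/-- `β_k ε_k² = n^{10}`. [folklore] -/
theorem beta_mul_eps_sq (k : ℕ) : nR k ^ 96 * epsW k ^ 2 = nR k ^ 10 := by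
  unfold epsW; field_simp [(nR_pos k).ne']

/-- `β_k δ_k² = 1`. [folklore] -/
theorem beta_mul_delta_sq (k : ℕ) : nR k ^ 96 * deltaW k ^ 2 = 1 := by
  unfold deltaW; field_simp [(nR_pos k).ne']

/-! ### Sizes of the torus -/

/-- The torus side as a real: `S_k = 2n² + 1`. [folklore] -/
theorem side_cast (k : ℕ) : ((2 * (k + 1) ^ 2 + 1 : ℕ) : ℝ) = 2 * nR k ^ 2 + 1 := by
  unfold nR; push_cast; ring

/-- `S_k ≤ 3n²`. [folklore] -/
theorem side_le (k : ℕ) : ((2 * (k + 1) ^ 2 + 1 : ℕ) : ℝ) ≤ 3 * nR k ^ 2 := by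
  rw [side_cast]; nlinarith [one_le_nR k]

/-- `S_k⁴ ≤ 81 n⁸`. [folklore] -/
theorem side_pow_four_le (k : ℕ) : ((2 * (k + 1) ^ 2 + 1 : ℕ) : ℝ) ^ 4 ≤ 81 * nR k ^ 8 := by
  calc ((2 * (k + 1) ^ 2 + 1 : ℕ) : ℝ) ^ 4 ≤ (3 * nR k ^ 2) ^ 4 :=
        pow_le_pow_left₀ (Nat.cast_nonneg _) (side_le k) 4
    _ = 81 * nR k ^ 8 := by ring

/-- `S_k ≤ 3n²` in `ℕ`. [folklore] -/
theorem side_le_nat (k : ℕ) : 2 * (k + 1) ^ 2 + 1 ≤ 3 * (k + 1) ^ 2 := by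
  have h1 : 1 ≤ (k + 1) ^ 2 := Nat.one_le_pow _ _ (Nat.succ_pos k)
  linarith

/-- `#Plaquette = 6 S⁴`. [folklore] -/
theorem card_plaquette (S : ℕ) [NeZero S] : Fintype.card (Plaquette 4 S) = S ^ 4 * 6 := by
  rw [Fintype.card_prod, Fintype.card_fun, ZMod.card, Fintype.card_fin, card_planes]

/-- `#Edge = 4 S⁴`. [folklore] -/
theorem card_edge (S : ℕ) [NeZero S] : Fintype.card (Edge 4 S) = S ^ 4 * 4 := by
  rw [Fintype.card_prod, Fintype.card_fun, ZMod.card, Fintype.card_fin]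

/-- `#Plaquette(S_k) ≤ 486 n⁸`. [folklore] -/
theorem card_plaquette_le (k : ℕ) : (Fintype.card (Plaquette 4 (2 * (k + 1) ^ 2 + 1)) : ℝ) ≤ 486 * nR k ^ 8 := by
  rw [card_plaquette]; push_cast
  have := side_pow_four_le k; push_cast at this
  linarith

/-- `#Edge(S_k) ≤ 324 n⁸` in `ℕ`. [folklore] -/
theorem card_edge_le_nat (k : ℕ) : Fintype.card (Edge 4 (2 * (k + 1) ^ 2 + 1)) ≤ 324 * (k + 1) ^ 8 := by
  rw [card_edge]
  calc (2 * (k + 1) ^ 2 + 1) ^ 4 * 4 ≤ (3 * (k + 1) ^ 2) ^ 4 * 4 :=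
        Nat.mul_le_mul_right _ (Nat.pow_le_pow_left (side_le_nat k) 4)
    _ = 324 * (k + 1) ^ 8 := by ring

/-! ### The smallness conditions along the scheme -/

/-- `S_k⁴ ε_k ≤ 81 n^{-35}`. [folklore] -/
theorem side_pow_four_mul_eps_le (k : ℕ) :
    ((2 * (k + 1) ^ 2 + 1 : ℕ) : ℝ) ^ 4 * epsW k ≤ 81 * (nR k ^ 35)⁻¹ := by
  have h := side_pow_four_le k
  have hn := nR_pos k
  calc ((2 * (k + 1) ^ 2 + 1 : ℕ) : ℝ) ^ 4 * epsW k ≤ 81 * nR k ^ 8 * epsW k :=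
        mul_le_mul_of_nonneg_right h (epsK_pos k).le
    _ = 81 * (nR k ^ 35)⁻¹ := by unfold epsW; field_simp

/-- `β_k #P ε_k⁴ ≤ 486 n^{-68}`. [folklore] -/
theorem beta_card_eps_four_le (k : ℕ) :
    nR k ^ 96 * Fintype.card (Plaquette 4 (2 * (k + 1) ^ 2 + 1)) * epsW k ^ 4 ≤ 486 * (nR k ^ 68)⁻¹ := by
  have h := card_plaquette_le k
  have hn := nR_pos k
  calc nR k ^ 96 * Fintype.card (Plaquette 4 (2 * (k + 1) ^ 2 + 1)) * epsW k ^ 4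
      ≤ nR k ^ 96 * (486 * nR k ^ 8) * epsW k ^ 4 := by gcongr
    _ = 486 * (nR k ^ 68)⁻¹ := by unfold epsW; field_simp

/-- `#P (ε_k √β_k)^{-6} ≤ 486 n^{-22}`. [folklore] -/
theorem card_tail_le (k : ℕ) :
    Fintype.card (Plaquette 4 (2 * (k + 1) ^ 2 + 1)) * (epsW k * Real.sqrt (nR k ^ 96))⁻¹ ^ 6 ≤
      486 * (nR k ^ 22)⁻¹ := by
  rw [eps_mul_sqrt_beta]
  have h := card_plaquette_le k
  have hn := nR_pos k
  calc (Fintype.card (Plaquette 4 (2 * (k + 1) ^ 2 + 1)) : ℝ) * (nR k ^ 5)⁻¹ ^ 6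
      ≤ 486 * nR k ^ 8 * (nR k ^ 5)⁻¹ ^ 6 := by gcongr
    _ = 486 * (nR k ^ 22)⁻¹ := by field_simp

/-- `1 ≤ ε_k √β_k`. [folklore] -/
theorem one_le_eps_mul_sqrt_beta (k : ℕ) : 1 ≤ epsW k * Real.sqrt (nR k ^ 96) := by
  rw [eps_mul_sqrt_beta]; exact one_le_pow₀ (one_le_nR k)

/-- `n_k → ∞`. [folklore] -/
theorem tendsto_nR : Tendsto nR atTop atTop :=
  tendsto_natCast_atTop_atTop.atTop_add tendsto_const_nhds

/-- `c · n^{-m} → 0` (`m ≥ 1`). [folklore] -/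
theorem tendsto_const_mul_inv_pow (c : ℝ) {m : ℕ} (hm : 1 ≤ m) :
    Tendsto (fun k => c * (nR k ^ m)⁻¹) atTop (𝓝 0) := by
  have h : Tendsto (fun k => (nR k ^ m)⁻¹) atTop (𝓝 0) :=
    tendsto_inv_atTop_zero.comp (tendsto_pow_atTop (by omega) |>.comp tendsto_nR)
  simpa using h.const_mul c

/-- Eventually `c · n^{-m} ≤ b` for any `b > 0` (`m ≥ 1`). [folklore] -/
theorem eventually_const_mul_inv_pow_le (c : ℝ) {m : ℕ} (hm : 1 ≤ m) {b : ℝ} (hb : 0 < b) :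
    ∀ᶠ k in atTop, c * (nR k ^ m)⁻¹ ≤ b :=
  (tendsto_const_mul_inv_pow c hm).eventually (eventually_le_nhds hb)

/-! ### The large-field estimate along the scheme -/

/-- **Large-field estimate, real form**: for `β ≥ 0`, `ε ≥ 0`, `0 < δ`, `4δ ≤ π`,
`μ_β(G_εᶜ) ≤ e^{−β(1−cos ε)} (δ/π)^{−#E} e^{β #P (1 − cos 4δ)}`. [folklore] -/
theorem eta_real_le (S : ℕ) [NeZero S] {β ε δ : ℝ} (hβ : 0 ≤ β) (hε : 0 ≤ ε) (hδ0 : 0 < δ)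
    (h4 : 4 * δ ≤ Real.pi) :
    (wilsonMeasure u1Rep β : Measure (GaugeConfig 4 S Circle)).real
        {U : GaugeConfig 4 S Circle | ∀ p : Plaquette 4 S, |plaqAngle U p| < ε}ᶜ ≤
      Real.exp (-(β * (1 - Real.cos ε))) * (((δ / Real.pi) ^ Fintype.card (Edge 4 S))⁻¹ *
        Real.exp (β * (Fintype.card (Plaquette 4 S) * (1 - Real.cos (4 * δ))))) := by
  have H := wilsonMeasure_u1_largePlaquette_le (L := S) (β := β) hβ hε hδ0 h4
  rw [← compl_goodSet_eq] at H
  have hq : 0 < δ / Real.pi := div_pos hδ0 Real.pi_pos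
  have hpow : (ENNReal.ofReal (δ / Real.pi) ^ Fintype.card (Edge 4 S))⁻¹ =
      ENNReal.ofReal (((δ / Real.pi) ^ Fintype.card (Edge 4 S))⁻¹) := by
    rw [← ENNReal.ofReal_pow hq.le, ENNReal.ofReal_inv_of_pos (pow_pos hq _)]
  rw [hpow, ← ENNReal.ofReal_mul (by positivity), ← ENNReal.ofReal_mul (by positivity)] at H
  rw [measureReal_def]
  refine (ENNReal.toReal_mono ENNReal.ofReal_ne_top H).trans ?_
  rw [ENNReal.toReal_ofReal (by positivity)]

/-- `1 − cos ε ≥ ε²/4` for `0 ≤ ε ≤ 1`. [folklore] -/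
theorem quarter_sq_le_one_sub_cos {ε : ℝ} (h0 : 0 ≤ ε) (h1 : ε ≤ 1) : ε ^ 2 / 4 ≤ 1 - Real.cos ε := by
  have h := Literature.Probability.LatticeModels.cos_le_one_sub_sq_half_add_fourth ε
  have h4 : ε ^ 4 ≤ ε ^ 2 := by
    rw [show ε ^ 4 = ε ^ 2 * ε ^ 2 by ring]
    exact mul_le_of_le_one_right (sq_nonneg _) (by nlinarith)
  nlinarith

/-- **Large-field estimate along the scheme**: for `k ≥ 1`,
`μ_{β_k}(G_{ε_k}ᶜ) ≤ exp(−n^{10}/4 + 20412 n⁹)` on the torus of side `S_k`. [folklore] -/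
theorem eta_scheme_le (k : ℕ) (hk : 1 ≤ k) :
    (wilsonMeasure u1Rep (nR k ^ 96) : Measure (GaugeConfig 4 (2 * (k + 1) ^ 2 + 1) Circle)).real
        {U : GaugeConfig 4 (2 * (k + 1) ^ 2 + 1) Circle |
          ∀ p : Plaquette 4 (2 * (k + 1) ^ 2 + 1), |plaqAngle U p| < epsW k}ᶜ ≤
      Real.exp (-(nR k ^ 10) / 4 + 20412 * nR k ^ 9) := by
  have hn := nR_pos k
  have hn1 := one_le_nR k
  have hn2 : 2 ≤ nR k := by
    have h1 : (1 : ℝ) ≤ k := by exact_mod_cast hk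
    unfold nR; linarith
  have hδ := deltaK_pos k
  have h4 : 4 * deltaW k ≤ Real.pi := by
    have : deltaW k ≤ 1 / 2 := (deltaK_le_inv k).trans (by rw [inv_le_comm₀ hn (by norm_num)]; linarith)
    linarith [Real.pi_gt_three]
  refine (eta_real_le (2 * (k + 1) ^ 2 + 1) (pow_nonneg hn.le 96) (epsK_pos k).le hδ h4).trans ?_
  -- the three factors
  have f1 : Real.exp (-(nR k ^ 96 * (1 - Real.cos (epsW k)))) ≤ Real.exp (-(nR k ^ 10) / 4) := by
    refine Real.exp_le_exp.2 ?_
    have h := mul_le_mul_of_nonneg_left (quarter_sq_le_one_sub_cos (epsK_pos k).le (epsK_le_one k))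
      (pow_nonneg hn.le 96)
    rw [show nR k ^ 96 * (epsW k ^ 2 / 4) = nR k ^ 10 / 4 by rw [← beta_mul_eps_sq]; ring] at h
    linarith
  have f2 : ((deltaW k / Real.pi) ^ Fintype.card (Edge 4 (2 * (k + 1) ^ 2 + 1)))⁻¹ ≤
      Real.exp (324 * nR k ^ 8 * (3 + 48 * nR k)) := by
    have hq : 0 < deltaW k / Real.pi := div_pos hδ Real.pi_pos
    have hbase : 1 ≤ Real.pi / deltaW k := by
      rw [le_div_iff₀ hδ, one_mul]
      exact ((deltaK_le_inv k).trans (inv_le_one_of_one_le₀ hn1)).trans (by linarith [Real.pi_gt_three])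
    rw [← inv_pow, inv_div]
    calc (Real.pi / deltaW k) ^ Fintype.card (Edge 4 (2 * (k + 1) ^ 2 + 1))
        ≤ (Real.pi / deltaW k) ^ (324 * (k + 1) ^ 8) := pow_le_pow_right₀ hbase (card_edge_le_nat k)
      _ = Real.exp ((324 * (k + 1) ^ 8 : ℕ) * Real.log (Real.pi / deltaW k)) := by
          rw [Real.exp_nat_mul, Real.exp_log (by positivity)]
      _ ≤ Real.exp (324 * nR k ^ 8 * (3 + 48 * nR k)) := by
          refine Real.exp_le_exp.2 ?_
          have hcast : ((324 * (k + 1) ^ 8 : ℕ) : ℝ) = 324 * nR k ^ 8 := by unfold nR; push_cast; ring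
          rw [hcast]
          refine mul_le_mul_of_nonneg_left ?_ (by positivity)
          rw [Real.log_div Real.pi_pos.ne' hδ.ne', deltaW, Real.log_inv, Real.log_pow, sub_neg_eq_add]
          have l1 : Real.log Real.pi ≤ 3 := by linarith [Real.log_le_sub_one_of_pos Real.pi_pos, Real.pi_lt_four]
          have l2 : Real.log (nR k) ≤ nR k := by linarith [Real.log_le_sub_one_of_pos hn]
          push_cast
          linarith
  have f3 : Real.exp (nR k ^ 96 * (Fintype.card (Plaquette 4 (2 * (k + 1) ^ 2 + 1)) *
      (1 - Real.cos (4 * deltaW k)))) ≤ Real.exp (3888 * nR k ^ 8) := by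
    refine Real.exp_le_exp.2 ?_
    have hc := card_plaquette_le k
    have hcos : 1 - Real.cos (4 * deltaW k) ≤ 8 * deltaW k ^ 2 := by
      have := Real.one_sub_sq_div_two_le_cos (x := 4 * deltaW k); nlinarith
    calc nR k ^ 96 * (Fintype.card (Plaquette 4 (2 * (k + 1) ^ 2 + 1)) * (1 - Real.cos (4 * deltaW k)))
        ≤ nR k ^ 96 * ((486 * nR k ^ 8) * (8 * deltaW k ^ 2)) := by
          refine mul_le_mul_of_nonneg_left ?_ (by positivity)
          exact mul_le_mul hc hcos (by linarith [Real.cos_le_one (4 * deltaW k)]) (by positivity)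
      _ = 3888 * nR k ^ 8 * (nR k ^ 96 * deltaW k ^ 2) := by ring
      _ = 3888 * nR k ^ 8 := by rw [beta_mul_delta_sq, mul_one]
  calc Real.exp (-(nR k ^ 96 * (1 - Real.cos (epsW k)))) *
        (((deltaW k / Real.pi) ^ Fintype.card (Edge 4 (2 * (k + 1) ^ 2 + 1)))⁻¹ *
          Real.exp (nR k ^ 96 * (Fintype.card (Plaquette 4 (2 * (k + 1) ^ 2 + 1)) *
            (1 - Real.cos (4 * deltaW k)))))
      ≤ Real.exp (-(nR k ^ 10) / 4) * (Real.exp (324 * nR k ^ 8 * (3 + 48 * nR k)) *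
          Real.exp (3888 * nR k ^ 8)) := by
        refine mul_le_mul f1 (mul_le_mul f2 f3 (by positivity) (by positivity)) (by positivity) (by positivity)
    _ = Real.exp (-(nR k ^ 10) / 4 + (324 * nR k ^ 8 * (3 + 48 * nR k) + 3888 * nR k ^ 8)) := by
        rw [← Real.exp_add, ← Real.exp_add]
    _ ≤ Real.exp (-(nR k ^ 10) / 4 + 20412 * nR k ^ 9) := by
        refine Real.exp_le_exp.2 ?_
        have h8 : nR k ^ 8 ≤ nR k ^ 9 := pow_le_pow_right₀ hn1 (by norm_num)
        have h9 : nR k ^ 8 * nR k = nR k ^ 9 := by ring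
        nlinarith [pow_nonneg hn.le 8]

/-- **Eventually the large-field probability is below `n^{-312}`.** [folklore] -/
theorem eta_eventually_le :
    ∀ᶠ k in atTop,
      (wilsonMeasure u1Rep (nR k ^ 96) : Measure (GaugeConfig 4 (2 * (k + 1) ^ 2 + 1) Circle)).real
          {U : GaugeConfig 4 (2 * (k + 1) ^ 2 + 1) Circle |
            ∀ p : Plaquette 4 (2 * (k + 1) ^ 2 + 1), |plaqAngle U p| < epsW k}ᶜ ≤ (nR k ^ 312)⁻¹ := by
  filter_upwards [eventually_ge_atTop 163296] with k hk
  have hn := nR_pos k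
  have hk1 : 1 ≤ k := le_trans (by norm_num) hk
  have hnk : (163297 : ℝ) ≤ nR k := by unfold nR; exact_mod_cast Nat.succ_le_succ hk
  refine (eta_scheme_le k hk1).trans ?_
  -- `exp(−n¹⁰/4 + 20412 n⁹) ≤ exp(−n¹⁰/8) ≤ n^{-312}`
  have h9 : 20412 * nR k ^ 9 ≤ nR k ^ 10 / 8 := by
    rw [show nR k ^ 10 = nR k * nR k ^ 9 by ring]
    nlinarith [pow_nonneg hn.le 9]
  have hlog : 312 * Real.log (nR k) ≤ nR k ^ 10 / 8 := by
    have l2 : Real.log (nR k) ≤ nR k := by linarith [Real.log_le_sub_one_of_pos hn]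
    have : (2496 : ℝ) * nR k ≤ nR k ^ 10 := by
      rw [show nR k ^ 10 = nR k ^ 9 * nR k by ring]
      refine mul_le_mul_of_nonneg_right ?_ hn.le
      calc (2496 : ℝ) ≤ 163297 ^ 9 := by norm_num
        _ ≤ nR k ^ 9 := pow_le_pow_left₀ (by norm_num) hnk 9
    nlinarith
  rw [← Real.exp_log (pow_pos hn 312), ← Real.exp_neg, Real.log_pow]
  refine Real.exp_le_exp.2 ?_
  push_cast
  linarith

end Summit.QuantumFields.YangMills.Theorems.SelfNormalisedSkewness.Negative

end
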